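import Summits.CriticalPhenomena.PercolationContinuityZ3.Theorems.Transplant.SkelFrmFrom1RootGlueQVK
import Summits.CriticalPhenomena.PercolationContinuityZ3.Theorems.Transplant.SkelFrmFromBChoiceDefsVPx
import Summits.CriticalPhenomena.PercolationContinuityZ3.Theorems.Transplant.SkelFrmFrom1ChoiceDefsPx
import HarnessLib

/-!
# U_s execution (RULING D-Us / Us-R3 / Us-R5, lead g22 2026-08-26; WAVE-Us-MANIFEST v1.0 §3 GEN row «SkelFrm1RootGlueQVK» ↦ «SkelFrmFrom1RootGlueQVKPx»):
# **the GEN (R) column glue AT RADIUS `D`** — `PlanarSkeletonFrmFrom.rootHoldsNQWFnLKPxAt_frmChoiceAllQ3VPx_of_axes`: per-axis root legs at the Px choice data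
# ⇒ `RootHoldsNQWFnLKPxAt Lf Kmin (frmChoiceAllQ3VPx D …)` — the shape the (R) top states ∀ D (RULING Us-R5 (ii), p465608's hypothesis shapes)

builds on p205010 (kernel theorem, internal audit signed; external expert review pending) — nothing in this file uses p205010; NOTHING is claimed about the
OPEN node U_s `SamePDropOfSkeletonFrmScaled₁` (U is CLOSED, «SkelFrmFrom1HoldsAll», untouched).  Lane `prim-bschramm`, seat `prim-bschramm-p3` gen 27 (design owner;
(R)-column pen by RULING Us-R3); helper file (`--supports stmt-CriticalPhenomena-4575 --as helper`); GEN row, hunk class (i) ONLY: `Φ.types = {t} ↦ Φ.HasProxies t D`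
in the hypothesis `h`, `choiceAtQ3V ↦ choiceAtQ3VPx … D` (gen-1's «SkelFrmFromBChoiceDefsVPx», seed floor `max m₀ D`), conclusion `RootHoldsNQWFnLK … (frmChoiceAllQ3V …) ↦
RootHoldsNQWFnLKPxAt … (frmChoiceAllQ3VPx D …)` («SkelFrmFrom1ChoiceDefsPx» §2); proof text verbatim over `frmChoiceAllQ3VPx_eq/_scheme`.
[cite: KozmaNitzan2024, §4 p. 28 ((32) at the root)] [cite: BenjaminiSchramm1996, Conj. 4] [this work]
-/

noncomputable section

open scoped Classical

namespace Summit.CriticalPhenomena.PercolationContinuityZ3.Theorems.Transplant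

open MeasureTheory Literature.Probability.Percolation Literature.Probability.LatticeModels SimpleGraph KNCells KNLevels

namespace PlanarSkeletonFrmFrom

open SkelConc (Consts)
open Skelφ.StepI (OutNS)
open Skel (winGraph)

/-- **THE GEN (R) COLUMN K-PROP AT RADIUS `D` FROM THE PER-AXIS ROOT LEGS** — GEN twin of `rootHoldsNQWFnLK_frmChoiceAllQ3V_of_axes`
(«SkelFrmFrom1RootGlueQVK»): per-axis root legs at the Px choice data `NegB.choiceAtQ3VPx … D …` under `Φ.HasProxies t D` (in place of `Φ.types = {t}`) give
`RootHoldsNQWFnLKPxAt Lf Kmin (frmChoiceAllQ3VPx D gv fv Pv Sv cv hv bv)` (gen-1's forms of record, «SkelFrmFrom1ChoiceDefsPx» §2 / «SkelFrmFromBChoiceDefsVPx» §3);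
proof = the U glue verbatim over `frmChoiceAllQ3VPx_eq/_scheme` and `Skel.rootOblTWF_of_axes`. [cite: KozmaNitzan2024, §4 p. 28 ((32) at the root)] -/
theorem rootHoldsNQWFnLKPxAt_frmChoiceAllQ3VPx_of_axes (Lf : ℕ → ℕ) (Kmin D : ℕ) (gv fv : Neg.FSlot) (Pv : NegB.PSlot) (Sv : NegB.SSlot) (cv hv : NegB.CSlot) (bv : NegB.BSlot)
    (h : ∀ (κ : Consts) {V : Type} [DecidableEq V] [Countable V] (G : SimpleGraph V) [G.LocallyFinite] (Φ : PlanarSkeletonFrmFrom G) (t : V) (p : unitInterval)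
      (hC : Φ.CylSubcritical p) (O : OutNS V) (q : unitInterval), Kmin ≤ κ.K₀ → (NegB.choiceAtQ3VPx κ Φ t p D Pv gv fv Sv cv hv bv hC).AtQNQ O q →
      Φ.HasProxies t D → 0 < (p : ℝ) → (p : ℝ) < 1 → FlatQ Lf κ → ∀ a : Fin 2,
      ∃ n, n ≤ Lf κ.K₀ ∧ ∃ (c : V) (Rπ : ℕ) (W : Sym2 V → unitInterval) (s : Fin (n + 1) → KNLevels.TStep (winGraph G c Rπ))
        (T' : Fin (n + 1) → Finset V) (η : ℝ),
        (∀ T : Finset V, (prodBernoulli W).real (⋃ t' ∈ T, openConn (NegB.ΓQV κ Φ t p O gv fv Sv cv hv bv q).root t') ≤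
          (prodBernoulli (pinW (KNLevels.lattW G q) ↑((⟨NegB.ΓQV κ Φ t p O gv fv Sv cv hv bv q, q, κ.δ⟩ : KSchA V ℕ).U₀ G)
            ↑((⟨NegB.ΓQV κ Φ t p O gv fv Sv cv hv bv q, q, κ.δ⟩ : KSchA V ℕ).U₀ G))).real
            (⋃ t' ∈ (↑T : Set V), openConnIn (↑((NegB.ΓQV κ Φ t p O gv fv Sv cv hv bv q).Q (NegB.ΓQV κ Φ t p O gv fv Sv cv hv bv q).a₀ 0 ∪
              (NegB.ΓQV κ Φ t p O gv fv Sv cv hv bv q).Ewv (NegB.ΓQV κ Φ t p O gv fv Sv cv hv bv q).a₀ 0 ((a, true) : MDir)) : Set V)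
              (NegB.ΓQV κ Φ t p O gv fv Sv cv hv bv q).root t')) ∧
        (∀ i : Fin (n + 1), (s i).L.o = (NegB.ΓQV κ Φ t p O gv fv Sv cv hv bv q).root) ∧
        (∀ i : Fin n, T' (Fin.castSucc i) ⊆ (s i.succ).L.X 0) ∧ (∀ i : Fin (n + 1), T' i ⊆ (s i).T) ∧
        (∀ i : Fin (n + 1), (s i).KitsAtF W q Φ.Δ (κ.δr 0)) ∧ η ≤ κ.δr 0 / 2 ∧
        (∀ i : Fin (n + 1), (prodBernoulli W).real (⋃ t' ∈ (s i).T \ T' i, openConn (NegB.ΓQV κ Φ t p O gv fv Sv cv hv bv q).root t') ≤ η) ∧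
        1 - κ.δr 0 < (prodBernoulli W).real (s 0).L.reachB ∧
        T' (Fin.last n) ⊆ (NegB.ΓQV κ Φ t p O gv fv Sv cv hv bv q).M (NegB.ΓQV κ Φ t p O gv fv Sv cv hv bv q).a₀ ((0 : Site 2) + stepVec ((a, true) : MDir))) :
    RootHoldsNQWFnLKPxAt Lf Kmin (frmChoiceAllQ3VPx D gv fv Pv Sv cv hv bv) := by
  intro κ V _ _ G _ Φ hg t ht hP p hp0 hp1 hC hK hflat O q hAt
  rw [frmChoiceAllQ3VPx_eq] at hAt
  rw [frmChoiceAllQ3VPx_scheme]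
  refine Skel.rootOblTWF_of_axes fun a => ?_
  obtain ⟨n, hn, c, Rπ, W, s, T', η, htr, ho, hlink, hsub, hkits, hη, hexc, hsrc, hlast⟩ := h κ G Φ t p hC O q hK hAt hP hp0 hp1 hflat a
  refine ⟨n, c, Rπ, W, s, T', η, htr, ho, hlink, hsub, ?_, ?_, hexc, ?_, hlast⟩
  · rw [hflat n hn]; exact hkits
  · rw [hflat n hn]; exact hη
  · rw [hflat n hn]; exact hsrc

end PlanarSkeletonFrmFrom

end Summit.CriticalPhenomena.PercolationContinuityZ3.Theorems.Transplant

end
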